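import Literature.NumberTheory.Sieve.SieveAdjoint
import HarnessLib

/-!
# The least-`β` and greatest-`β` pins of the `β`-sieve data: consequences of necessity

Trunk `AntSieve` (topic `NumberTheory/Sieve`). `SieveFunctions` chooses canonical `β`-sieve data
twice: `betaSieveData κ` with `β` LEAST among normalised solutions (`IsBetaSieveData`;
`upperSieveFun`, `lowerSieveFun`, `siftingLimit`, `betaSieveConst`) and, in its correction section,
`greatestBetaSieveData κ` with `β` GREATEST (`IsGreatestBetaSieveData`; `iwaniecUpperSieveFun`,
`iwaniecLowerSieveFun`, `iwaniecSiftingLimit`, `iwaniecSieveConst`), the latter being Iwaniec's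
`β_κ = 1 +` the greatest zero of the adjoint `q_κ` [Greaves2001, (4.2.4.10)]. By the necessity
theorem `IsBetaSieveSolution.adjoint_apply_eq_zero` of `SieveAdjoint` and the polynomial adjoints
`q_{1/2} = 1`, `q_1 = s − 1` [Greaves2001, (4.2.3.3)], every normalised solution has `β = 1` for
`κ = 1/2` and `β = 2` for `κ = 1`; hence for these two dimensions — the half-dimensional and the
LINEAR sieve — both extremality clauses are vacuous, the two predicates coincide, and so do the
`Classical.epsilon`-chosen data, DEFINITIONALLY (no existence fact needed):
`upperSieveFun 1 = iwaniecUpperSieveFun 1`, `siftingLimit 1 = iwaniecSiftingLimit 1`, etc.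
(all PROVED). Consequently `iwaniecSiftingLimit 1 = 2` and `iwaniecSiftingLimit (1/2) = 1`
follow from `exists_isGreatestBetaSieveData` (the former unconditionally once the linear sieve
data are constructed, file `LinearSieveExistence`, planned), and the `κ = 1` and `κ = 1/2` cases
of `SieveSequence.jurkat_richert_upper` / `jurkat_richert_lower` follow from the corrected
corollaries `SieveSequence.Iwaniec1980_upper` / `Iwaniec1980_lower`
(`SieveSequence.linear_sieve_upper`, `…_lower`, `half_dimensional_sieve_upper`, `…_lower`,
PROVED).
For `κ = 3/2, 2` we record what necessity gives for `iwaniecSiftingLimit`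
(`β_{3/2} ∈ {(5 ± √3)/2}`, `q_2(β_2 − 1) = 0`) and the comparison
`siftingLimit κ ≤ iwaniecSiftingLimit κ`.

## References

* [Greaves2001] G. Greaves, *Sieves in Number Theory*, Springer (2001), §4.2.3 (3.3), §4.2.4
  (4.7), (4.9)–(4.10).
* [IwaniecActaArith1980] H. Iwaniec, *Rosser's sieve*, Acta Arith. 36 (1980), 171–202, Thm 1.
* [JurkatRichertActaArith1965] W. B. Jurkat, H.-E. Richert, Acta Arith. 11 (1965), Thm 4–5.
-/

open Filter Asymptotics Set Topology

noncomputable section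

namespace Literature.NumberTheory.Sieve

/-! ### Values of `iwaniecSiftingLimit` forced by necessity -/

/-- For `κ = 1` the maximality clause of `IsGreatestBetaSieveData` is automatic (all normalised
solutions have `β = 2`, `IsBetaSieveSolution.beta_eq_two`). [folklore] -/
theorem isGreatestBetaSieveData_one_iff (B : (ℝ → ℝ) × (ℝ → ℝ) × ℝ × ℝ) :
    IsGreatestBetaSieveData 1 B ↔ IsBetaSieveSolution 1 B.1 B.2.1 B.2.2.1 B.2.2.2 :=
  ⟨fun h => h.1, fun h => ⟨h, fun _ _ _ _ h' => by rw [h.beta_eq_two, h'.beta_eq_two]⟩⟩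

/-- For `κ = 1/2` the maximality clause of `IsGreatestBetaSieveData` is automatic (all normalised
solutions have `β = 1`, `IsBetaSieveSolution.beta_eq_one`). [folklore] -/
theorem isGreatestBetaSieveData_half_iff (B : (ℝ → ℝ) × (ℝ → ℝ) × ℝ × ℝ) :
    IsGreatestBetaSieveData (1 / 2) B ↔ IsBetaSieveSolution (1 / 2) B.1 B.2.1 B.2.2.1 B.2.2.2 :=
  ⟨fun h => h.1, fun h => ⟨h, fun _ _ _ _ h' => by rw [h.beta_eq_one, h'.beta_eq_one]⟩⟩

/-- **`β_1 = 2` for Iwaniec's pin** [Greaves2001, (4.2.4.10)]: granted existence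
(`exists_isGreatestBetaSieveData`), `iwaniecSiftingLimit 1 = 2`. (Unconditional once the linear
sieve data are constructed; see `LinearSieveExistence`.) [cite: Greaves2001, §4.2.4 (4.10)] -/
theorem iwaniecSiftingLimit_one_of_exists (hex : exists_isGreatestBetaSieveData) :
    iwaniecSiftingLimit 1 = 2 :=
  (isBetaSieveSolution_iwaniecUpperSieveFun_iwaniecLowerSieveFun hex (by norm_num)).beta_eq_two

/-- **`β_{1/2} = 1` for Iwaniec's pin** [Greaves2001, (4.2.4.10)]: granted existence,
`iwaniecSiftingLimit (1/2) = 1`. [cite: Greaves2001, §4.2.4 (4.10)] -/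
theorem iwaniecSiftingLimit_half (hex : exists_isGreatestBetaSieveData) :
    iwaniecSiftingLimit (1 / 2) = 1 :=
  (isBetaSieveSolution_iwaniecUpperSieveFun_iwaniecLowerSieveFun hex (by norm_num)).beta_eq_one

/-- `β_{3/2} ∈ {(5 − √3)/2, (5 + √3)/2}` by necessity (the literature value is the larger,
`(5 + √3)/2 = 3.36603` [Greaves2001, (4.2.4.10)]; excluding the smaller root from
`IsGreatestBetaSieveData` needs the existence of a normalised solution with `β = (5 + √3)/2`,
which is not extractable from `exists_isGreatestBetaSieveData`).
[cite: Greaves2001, §4.2.4 (4.7), (4.10)] -/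
theorem iwaniecSiftingLimit_three_halves (hex : exists_isGreatestBetaSieveData) :
    iwaniecSiftingLimit (3 / 2) = (5 - Real.sqrt 3) / 2 ∨
      iwaniecSiftingLimit (3 / 2) = (5 + Real.sqrt 3) / 2 :=
  (isBetaSieveSolution_iwaniecUpperSieveFun_iwaniecLowerSieveFun hex
    (by norm_num)).beta_eq_of_three_halves

/-- `q_2(β_2 − 1) = 0` for Iwaniec's pin, by necessity (`β_2 = 4.83399` is `1 +` the greatest root
[Greaves2001, (4.2.4.10)]). [cite: Greaves2001, §4.2.4 (4.7), (4.10)] -/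
theorem cubic_iwaniecSiftingLimit_two_eq_zero (hex : exists_isGreatestBetaSieveData) :
    (iwaniecSiftingLimit 2 - 1) ^ 3 - 6 * (iwaniecSiftingLimit 2 - 1) ^ 2 +
        9 * (iwaniecSiftingLimit 2 - 1) - 8 / 3 = 0 :=
  (isBetaSieveSolution_iwaniecUpperSieveFun_iwaniecLowerSieveFun hex (by norm_num)).cubic_eq_zero

/-! ### Comparison of the two pins -/

/-- The least admissible `β` is at most the greatest one: `siftingLimit κ ≤ iwaniecSiftingLimit κ`
for `κ ≥ 1/2`, granted both existence facts; for `κ > 1` the inequality is strict in general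
(e.g. `κ = 2`: `q_2` has three positive zeros, see `SieveAdjoint`). [folklore] -/
theorem siftingLimit_le_iwaniecSiftingLimit (hex : exists_isBetaSieveData)
    (hex' : exists_isGreatestBetaSieveData) {κ : ℝ} (hκ : 1 / 2 ≤ κ) :
    siftingLimit κ ≤ iwaniecSiftingLimit κ :=
  (isGreatestBetaSieveData_greatestBetaSieveData hex' hκ).2 _ _ _ _
    (isBetaSieveData_betaSieveData hex hκ).1

/-! ### `κ = 1` and `κ = 1/2`: the least-`β` and the greatest-`β` pins coincide -/

/-- For the linear sieve the two predicates coincide: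
`IsBetaSieveData 1 = IsGreatestBetaSieveData 1` (both reduce to `IsBetaSieveSolution 1`).
[folklore] -/
theorem isBetaSieveData_one_eq : IsBetaSieveData 1 = IsGreatestBetaSieveData 1 :=
  funext fun B =>
    propext ((isBetaSieveData_one_iff B).trans (isGreatestBetaSieveData_one_iff B).symm)

/-- For `κ = 1/2` the two predicates coincide. [folklore] -/
theorem isBetaSieveData_half_eq : IsBetaSieveData (1 / 2) = IsGreatestBetaSieveData (1 / 2) :=
  funext fun B =>
    propext ((isBetaSieveData_half_iff B).trans (isGreatestBetaSieveData_half_iff B).symm)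

/-- The chosen data coincide for `κ = 1`: `betaSieveData 1 = greatestBetaSieveData 1` (both are
`Classical.epsilon` of the same predicate; no existence fact is needed). [folklore] -/
theorem betaSieveData_one : betaSieveData 1 = greatestBetaSieveData 1 := by
  unfold betaSieveData greatestBetaSieveData
  rw [isBetaSieveData_one_eq]

/-- The chosen data coincide for `κ = 1/2`. [folklore] -/
theorem betaSieveData_half : betaSieveData (1 / 2) = greatestBetaSieveData (1 / 2) := by
  unfold betaSieveData greatestBetaSieveData
  rw [isBetaSieveData_half_eq]

/-- `F_1`: `upperSieveFun 1 = iwaniecUpperSieveFun 1`. [folklore] -/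
theorem upperSieveFun_one : upperSieveFun 1 = iwaniecUpperSieveFun 1 :=
  congrArg (fun B : (ℝ → ℝ) × (ℝ → ℝ) × ℝ × ℝ => B.1) betaSieveData_one

/-- `f_1`: `lowerSieveFun 1 = iwaniecLowerSieveFun 1`. [folklore] -/
theorem lowerSieveFun_one : lowerSieveFun 1 = iwaniecLowerSieveFun 1 :=
  congrArg (fun B : (ℝ → ℝ) × (ℝ → ℝ) × ℝ × ℝ => B.2.1) betaSieveData_one

/-- `β_1`: `siftingLimit 1 = iwaniecSiftingLimit 1`. [folklore] -/
theorem siftingLimit_one_eq_iwaniecSiftingLimit : siftingLimit 1 = iwaniecSiftingLimit 1 :=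
  congrArg (fun B : (ℝ → ℝ) × (ℝ → ℝ) × ℝ × ℝ => B.2.2.1) betaSieveData_one

/-- `A_1`: `betaSieveConst 1 = iwaniecSieveConst 1`. [folklore] -/
theorem betaSieveConst_one : betaSieveConst 1 = iwaniecSieveConst 1 :=
  congrArg (fun B : (ℝ → ℝ) × (ℝ → ℝ) × ℝ × ℝ => B.2.2.2) betaSieveData_one

/-- `F_{1/2}`: `upperSieveFun (1/2) = iwaniecUpperSieveFun (1/2)`. [folklore] -/
theorem upperSieveFun_half : upperSieveFun (1 / 2) = iwaniecUpperSieveFun (1 / 2) :=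
  congrArg (fun B : (ℝ → ℝ) × (ℝ → ℝ) × ℝ × ℝ => B.1) betaSieveData_half

/-- `f_{1/2}`: `lowerSieveFun (1/2) = iwaniecLowerSieveFun (1/2)`. [folklore] -/
theorem lowerSieveFun_half : lowerSieveFun (1 / 2) = iwaniecLowerSieveFun (1 / 2) :=
  congrArg (fun B : (ℝ → ℝ) × (ℝ → ℝ) × ℝ × ℝ => B.2.1) betaSieveData_half

/-- `β_{1/2}`: `siftingLimit (1/2) = iwaniecSiftingLimit (1/2)`. [folklore] -/
theorem siftingLimit_half_eq_iwaniecSiftingLimit :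
    siftingLimit (1 / 2) = iwaniecSiftingLimit (1 / 2) :=
  congrArg (fun B : (ℝ → ℝ) × (ℝ → ℝ) × ℝ × ℝ => B.2.2.1) betaSieveData_half

/-! ### The linear and half-dimensional cases of `jurkat_richert_upper` / `_lower` -/

namespace SieveSequence

/-- **Linear sieve, upper bound, in the notation of `jurkat_richert_upper`** (Jurkat–Richert 1965;
[IwaniecActaArith1980, Thm 1] for `κ = 1`): the case `κ = 1` of `SieveSequence.jurkat_richert_upper`
(with `upperSieveFun 1`) follows from the corrected corollary `SieveSequence.Iwaniec1980_upper`,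
since `upperSieveFun 1 = iwaniecUpperSieveFun 1`. [cite: IwaniecActaArith1980, Thm 1] -/
theorem linear_sieve_upper (h : Iwaniec1980_upper) (A : SieveSequence) {L θ : ℝ} (hθ : 0 < θ)
    (hdim : HasIwaniecDimension A.density 1 L) (hlevel : HasLevelOfDistribution A θ)
    (hsize : ∀ᶠ x : ℝ in atTop, 0 ≤ A.size x) :
    ∀ ε δ : ℝ, 0 < ε → 0 < δ → ∀ᶠ x : ℝ in atTop, ∀ z : ℝ, 2 ≤ z → z ≤ x ^ (θ - δ) →
      A.sifted x (primesProdBelow z) ≤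
        A.size x * A.densityProduct (primesProdBelow z) *
          (upperSieveFun 1 (θ * Real.log x / Real.log z) + ε) := by
  rw [upperSieveFun_one]
  exact h A (by norm_num) hθ hdim hlevel hsize

/-- **Linear sieve, lower bound, in the notation of `jurkat_richert_lower`**: the case `κ = 1` of
`SieveSequence.jurkat_richert_lower` follows from `SieveSequence.Iwaniec1980_lower`.
[cite: IwaniecActaArith1980, Thm 1] -/
theorem linear_sieve_lower (h : Iwaniec1980_lower) (A : SieveSequence) {L θ : ℝ} (hθ : 0 < θ)
    (hdim : HasIwaniecDimension A.density 1 L) (hlevel : HasLevelOfDistribution A θ)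
    (hsize : ∀ᶠ x : ℝ in atTop, 0 ≤ A.size x) :
    ∀ ε δ : ℝ, 0 < ε → 0 < δ → ∀ᶠ x : ℝ in atTop, ∀ z : ℝ, 2 ≤ z → z ≤ x ^ (θ - δ) →
      A.size x * A.densityProduct (primesProdBelow z) *
          (lowerSieveFun 1 (θ * Real.log x / Real.log z) - ε) ≤
        A.sifted x (primesProdBelow z) := by
  rw [lowerSieveFun_one]
  exact h A (by norm_num) hθ hdim hlevel hsize

/-- **Half-dimensional sieve, upper bound, in the notation of `jurkat_richert_upper`**: the case
`κ = 1/2` of `SieveSequence.jurkat_richert_upper` follows from `SieveSequence.Iwaniec1980_upper`.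
[cite: IwaniecActaArith1980, Thm 1] -/
theorem half_dimensional_sieve_upper (h : Iwaniec1980_upper) (A : SieveSequence) {L θ : ℝ}
    (hθ : 0 < θ) (hdim : HasIwaniecDimension A.density (1 / 2) L)
    (hlevel : HasLevelOfDistribution A θ) (hsize : ∀ᶠ x : ℝ in atTop, 0 ≤ A.size x) :
    ∀ ε δ : ℝ, 0 < ε → 0 < δ → ∀ᶠ x : ℝ in atTop, ∀ z : ℝ, 2 ≤ z → z ≤ x ^ (θ - δ) →
      A.sifted x (primesProdBelow z) ≤
        A.size x * A.densityProduct (primesProdBelow z) *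
          (upperSieveFun (1 / 2) (θ * Real.log x / Real.log z) + ε) := by
  rw [upperSieveFun_half]
  exact h A le_rfl hθ hdim hlevel hsize

/-- **Half-dimensional sieve, lower bound, in the notation of `jurkat_richert_lower`**: the case
`κ = 1/2` of `SieveSequence.jurkat_richert_lower` follows from `SieveSequence.Iwaniec1980_lower`.
[cite: IwaniecActaArith1980, Thm 1] -/
theorem half_dimensional_sieve_lower (h : Iwaniec1980_lower) (A : SieveSequence) {L θ : ℝ}
    (hθ : 0 < θ) (hdim : HasIwaniecDimension A.density (1 / 2) L)
    (hlevel : HasLevelOfDistribution A θ) (hsize : ∀ᶠ x : ℝ in atTop, 0 ≤ A.size x) :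
    ∀ ε δ : ℝ, 0 < ε → 0 < δ → ∀ᶠ x : ℝ in atTop, ∀ z : ℝ, 2 ≤ z → z ≤ x ^ (θ - δ) →
      A.size x * A.densityProduct (primesProdBelow z) *
          (lowerSieveFun (1 / 2) (θ * Real.log x / Real.log z) - ε) ≤
        A.sifted x (primesProdBelow z) := by
  rw [lowerSieveFun_half]
  exact h A le_rfl hθ hdim hlevel hsize

end SieveSequence

end Literature.NumberTheory.Sieve
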